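import Summits.Ventures.Crystal3D.Theorems.StickyWulffConstantTextureLiminfZigOrRows
import Summits.Ventures.Crystal3D.Theorems.StickyWulffConstantTextureLiminfCellFluxMix
import Summits.Ventures.Crystal3D.Theorems.StickyWulffConstantTextureLiminfTexShadowCoverableSplitDefs
import HarnessLib

/-!
# Every admissible charge table is MIX-dominated at a launchable corner; the DEFICIENT part of the generic wall law always
# has a steep ROW family (lane T, crux `TextureLiminf`, stmt-Ventures-19483; TexShadow v6.10 three-way split ⇒ proposed v6.11 re-cut)

HONEST FRAMING. Venture `Summits/Ventures/Crystal3D` (cell `crystal3d-full`), helper `--supports` the crux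
`TextureLiminf` (stmt-Ventures-19483) of `route-Ventures-StickyWulffConstant`, registered line `TexShadow`.  Rung credit
only; F-C1 not moved.  NOT the wall law; not lane G's row family (its cap-start / off-reach are G's to build).

From ZIGZAG OR ROWS (`one_le_layerFlux_or_plateFlux`, `…ZigOrRows`): for every plate, at steepness `√2/2`, either the row flux is
`≥ 1` or the plate is Δ-steep with every strip's zigzag flux `≥ 1`.  Hence for EVERY pair of plates and EVERY table with
`c i j ≤ 1` (the first clause of `BilayerChargeAdmissible`):

* **`mixCorner_of_le_one`** — there is a corner `(a₁,b₁), (a₂,b₂) ∈ {(1,0),(0,1)}` with the chosen families LAUNCHABLE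
  (`aₖ = 1 ⇒ DeltaSteep`, `bₖ = 1 ⇒ √2/2 ≤ layerRise`) and `MixFluxDominated (√2/2) a₁ b₁ a₂ b₂ L₁ σ₁ L₂ σ₂ c`;
* **`deficient_has_steep_rows`** — under the hypothesis of `BilayerWallDeficient` (not both Δ-steep, or Barlow-coverable but not
  flux-dominated) that corner uses AT LEAST ONE ROW family (`b₁ = 1 ∨ b₂ = 1`).
So the orientation/table-deficient remainder of v6.9/v6.10 contains NO table beyond the reach of one walker-family PAIR per cell:
with lane G's row-family F4 (cap-start along `bestLayerDir`, launch `√2/2 ≤ layerRise`, row off-reach) and `bilayerWallAt_of_lineCount_mix`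
(`…LineCountGlueMix`) it is payable exactly like the covered part; what is left is an ON-REACH residual for the chosen pair.  Proposed
v6.11 re-cut (planner): Generic = ZigCovered [closed mod E1/StarPairFar, p654251] ∪ RowCovered [this corner, G's row F4] ∪ OnReach
[zig or row reach obstructed]; the (L3) certificate road for a «zigzag deficit» is not needed.
WHAT THIS IS NOT: not the row F4; not the on-reach residual; F-C1 not moved.
-/

noncomputable section

namespace Summit.Ventures.Crystal3D.Theorems

open Literature.MathematicalPhysics.StatisticalMechanics (IsHaggSeq)
open Summit.Ventures.Crystal3D.Cruxes.TextureLiminf.TexShadow (E3 e₃ bilayerRise PlateLaunchable plateFlux layerRise layerFlux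
  layerFlux_nonneg FluxDominated MixFluxDominated DeltaSteep BarlowCoverable)
open scoped InnerProductSpace

/-- `‖e₃‖ = 1` and `‖−e₃‖ = 1`. -/
theorem norm_e₃_and_neg : ‖(e₃ : E3)‖ = 1 ∧ ‖(-e₃ : E3)‖ = 1 := by
  have h : ‖(e₃ : E3)‖ = 1 := by rw [e₃, PiLp.norm_single, norm_one]
  exact ⟨h, by rw [norm_neg, h]⟩

/-- **Every table `c ≤ 1` is MIX-dominated at a launchable corner** (per plate: rows if steep, else zigzags). -/
theorem mixCorner_of_le_one (L₁ L₂ : E3 ≃ₗᵢ[ℝ] E3) (σ₁ σ₂ : ℤ → ℤ) (c : ℤ → ℤ → ℝ) (hc1 : ∀ i j, c i j ≤ 1) :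
    ∃ a₁ b₁ a₂ b₂ : ℝ,
      ((a₁ = 1 ∧ b₁ = 0 ∧ DeltaSteep L₁ e₃) ∨ (a₁ = 0 ∧ b₁ = 1 ∧ Real.sqrt 2 / 2 ≤ layerRise L₁ e₃)) ∧
      ((a₂ = 1 ∧ b₂ = 0 ∧ DeltaSteep L₂ (-e₃)) ∨ (a₂ = 0 ∧ b₂ = 1 ∧ Real.sqrt 2 / 2 ≤ layerRise L₂ (-e₃))) ∧
      MixFluxDominated (Real.sqrt 2 / 2) a₁ b₁ a₂ b₂ L₁ σ₁ L₂ σ₂ c := by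
  obtain ⟨he, hne⟩ := norm_e₃_and_neg
  have hs2 : 0 < Real.sqrt 2 := Real.sqrt_pos.2 (by norm_num)
  have h2 : Real.sqrt 2 ^ 2 = 2 := Real.sq_sqrt (by norm_num)
  -- per plate: a weight pair and a flux profile `F ≥ 1`
  have plate : ∀ (L : E3 ≃ₗᵢ[ℝ] E3) (σ : ℤ → ℤ) (e : E3), ‖e‖ = 1 → ∃ a b : ℝ,
      ((a = 1 ∧ b = 0 ∧ DeltaSteep L e) ∨ (a = 0 ∧ b = 1 ∧ Real.sqrt 2 / 2 ≤ layerRise L e)) ∧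
      ∀ i, 1 ≤ a * plateFlux (Real.sqrt 2 / 2) L σ e i + b * layerFlux (Real.sqrt 2 / 2) L e := by
    intro L σ e he'
    rcases one_le_layerFlux_or_plateFlux L σ he' with h | ⟨hΔ, h⟩
    · refine ⟨0, 1, Or.inr ⟨rfl, rfl, ?_⟩, fun i => by simpa using h⟩
      -- `1 ≤ layerFlux` forces the rows to be steep (else the flux is `0`)
      by_contra hlt
      unfold layerFlux at h
      rw [if_neg hlt] at h
      linarith
    · exact ⟨1, 0, Or.inl ⟨rfl, rfl, hΔ⟩, fun i => by simpa using h i⟩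
  obtain ⟨a₁, b₁, h₁, hF₁⟩ := plate L₁ σ₁ e₃ he
  obtain ⟨a₂, b₂, h₂, hF₂⟩ := plate L₂ σ₂ (-e₃) hne
  refine ⟨a₁, b₁, a₂, b₂, h₁, h₂, fun i j => ?_⟩
  have := hF₁ i; have := hF₂ j; have := hc1 i j
  linarith

/-- **The deficient part always has a steep row family**: if the pair is not both Δ-steep, or is Barlow-coverable with a table
`0 ≤ c ≤ 1` that is NOT flux-dominated, then the corner of `mixCorner_of_le_one` can be taken with `b₁ = 1 ∨ b₂ = 1`. -/
theorem deficient_has_steep_rows (L₁ L₂ : E3 ≃ₗᵢ[ℝ] E3) (s₁ s₂ : E3) (σ₁ σ₂ : ℤ → ℤ) (c : ℤ → ℤ → ℝ)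
    (hc1 : ∀ i j, c i j ≤ 1)
    (hdef : ¬ (DeltaSteep L₁ e₃ ∧ DeltaSteep L₂ (-e₃)) ∨
      (BarlowCoverable L₁ s₁ σ₁ L₂ s₂ σ₂ ∧ ¬ FluxDominated (Real.sqrt 2 / 2) L₁ σ₁ L₂ σ₂ c)) :
    ∃ a₁ b₁ a₂ b₂ : ℝ,
      ((a₁ = 1 ∧ b₁ = 0 ∧ DeltaSteep L₁ e₃) ∨ (a₁ = 0 ∧ b₁ = 1 ∧ Real.sqrt 2 / 2 ≤ layerRise L₁ e₃)) ∧
      ((a₂ = 1 ∧ b₂ = 0 ∧ DeltaSteep L₂ (-e₃)) ∨ (a₂ = 0 ∧ b₂ = 1 ∧ Real.sqrt 2 / 2 ≤ layerRise L₂ (-e₃))) ∧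
      (b₁ = 1 ∨ b₂ = 1) ∧
      MixFluxDominated (Real.sqrt 2 / 2) a₁ b₁ a₂ b₂ L₁ σ₁ L₂ σ₂ c := by
  obtain ⟨he, hne⟩ := norm_e₃_and_neg
  have hs2 : 0 < Real.sqrt 2 := Real.sqrt_pos.2 (by norm_num)
  -- the two dichotomies
  rcases one_le_layerFlux_or_plateFlux L₁ σ₁ he with hR₁ | ⟨hΔ₁, hZ₁⟩
  · -- plate 1 rows steep: corner (0,1) for plate 1, anything launchable for plate 2
    have hst₁ : Real.sqrt 2 / 2 ≤ layerRise L₁ e₃ := by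
      by_contra hlt; unfold layerFlux at hR₁; rw [if_neg hlt] at hR₁; linarith
    rcases one_le_layerFlux_or_plateFlux L₂ σ₂ hne with hR₂ | ⟨hΔ₂, hZ₂⟩
    · have hst₂ : Real.sqrt 2 / 2 ≤ layerRise L₂ (-e₃) := by
        by_contra hlt; unfold layerFlux at hR₂; rw [if_neg hlt] at hR₂; linarith
      refine ⟨0, 1, 0, 1, Or.inr ⟨rfl, rfl, hst₁⟩, Or.inr ⟨rfl, rfl, hst₂⟩, Or.inl rfl, fun i j => ?_⟩
      have := hc1 i j; simp only [zero_mul, one_mul, zero_add]; linarith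
    · refine ⟨0, 1, 1, 0, Or.inr ⟨rfl, rfl, hst₁⟩, Or.inl ⟨rfl, rfl, hΔ₂⟩, Or.inl rfl, fun i j => ?_⟩
      have := hc1 i j; have := hZ₂ j; simp only [zero_mul, one_mul, zero_add, add_zero]; linarith
  · rcases one_le_layerFlux_or_plateFlux L₂ σ₂ hne with hR₂ | ⟨hΔ₂, hZ₂⟩
    · have hst₂ : Real.sqrt 2 / 2 ≤ layerRise L₂ (-e₃) := by
        by_contra hlt; unfold layerFlux at hR₂; rw [if_neg hlt] at hR₂; linarith
      refine ⟨1, 0, 0, 1, Or.inl ⟨rfl, rfl, hΔ₁⟩, Or.inr ⟨rfl, rfl, hst₂⟩, Or.inr rfl, fun i j => ?_⟩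
      have := hc1 i j; have := hZ₁ i; simp only [zero_mul, one_mul, zero_add, add_zero]; linarith
    · -- both plates Δ-steep with zigzag fluxes ≥ 1: then the table IS flux-dominated — the deficient hypothesis is void
      exfalso
      rcases hdef with h | ⟨-, h⟩
      · exact h ⟨hΔ₁, hΔ₂⟩
      · apply h
        intro i j
        have := hc1 i j; have := hZ₁ i; have := hZ₂ j
        linarith

end Summit.Ventures.Crystal3D.Theorems

end
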